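import Mathlib.Algebra.Category.MonCat.Basic
import Mathlib.CategoryTheory.Opposites
import Mathlib.GroupTheory.MonoidLocalization.GrothendieckGroup
import Mathlib.NumberTheory.Real.Irrational
import Literature.AlgebraicGeometry.Frobenioids.Monoids
import Literature.AnabelianGeometry.EtaleTheta.Conventions

/-!
# [EtTh] §3, part 2: the monoids `Φ₀`, `B₀` of Definition 3.3 (iii), Proposition 3.4,
# Lemma 3.5 and Remarks 3.3.1, 3.5.1, 3.5.2

Source: [MochizukiEtTh2009] §3, PDF pp. 73–76 (printed 299–302). Locators `p.N` = PDF page.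

## Definition 3.3 (iii) (p.73), as typed here

"for any connected tempered covering `Y^log → X^log`, it makes sense to define
`Φ₀(Y^log) := lim_{→ Z^log_∞} Div⁺(Z^log_∞)^{Gal(Z^log_∞/Y^log)}`;
`B₀(Y^log) := lim_{→ Z^log_∞} Mero(Z^log_∞)^{Gal(Z^log_∞/Y^log)}` — where the inductive limits
range over the `Δ^fil`-closures `Z^log_∞ → Y^log` of `Y^log → X^log` …. the assignments
`Y^log ↦ Φ₀(Y^log)`, `Y^log ↦ B₀(Y^log)` determine functors `Φ₀ : D₀ → 𝔐𝔬𝔫`; `B₀ : D₀ → 𝔐𝔬𝔫` …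
together with a natural transformation `B₀ → Φ₀^gp` [given by assigning to a log-meromorphic
function its log-divisor of zeroes and poles], whose image we denote by `Φ₀^birat ⊆ Φ₀^gp`. Also,
we shall write `F₀ ⊆ B₀` for the subfunctor determined by the constant log-meromorphic functions
and `Φ₀^cnst ⊆ Φ₀^gp` for the image of `F₀` in `Φ₀^gp`."

The inductive-limit CONSTRUCTION needs the tower of universal combinatorial coverings
(`TemperedCoverings.lean` gives one layer as an interface; the tower is [SemiAnbd] §3 material,
seat abc-iut-L3-t2) and is not carried out here: `DivisorMonoids D₀` records its OUTPUT — the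
functors `Φ₀`, `B₀` (contravariant functors to commutative monoids, the encoding
`D₀ᵒᵖ ⥤ CommMonCat` of a "monoid on `D₀`" used in `Literature/AlgebraicGeometry/Frobenioids/`),
the transformation `B₀ → Φ₀^gp`, the subfunctor `F₀`, and the non-cuspidal/cuspidal submonoids
(needed in Def. 3.6 (iii)) — as DATA, every field quoting the printed definition. `Φ₀^birat`,
`Φ₀^cnst` are then defined. Proposition 3.4 becomes the hypothesis structure
`DivisorMonoids.Prop34` over the [FrdI] vocabulary that is not yet in the tree
(`FrdIMonoidStub` / `FrdICatStub`,
TODO-merge: abc-iut-L1-t2 for [FrdI] Def. 2.4, abc-iut-found for Def. 1.1, abc-iut-L1-t3 for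
Def. 4.5); Lemma 3.5 and Remark 3.5.1 are named `Prop`s over the same vocabulary; Remark 3.5.2
(the counterexample) is PROVED in a concrete form.
-/

namespace Literature.AnabelianGeometry.EtaleTheta

open CategoryTheory Opposite Literature.AlgebraicGeometry.Frobenioids

universe u v w

/-! ## Groupification of a homomorphism (plumbing) -/

section Gp

variable {M N : Type w} [CommMonoid M] [CommMonoid N]

/-- The homomorphism `M^gp → N^gp` induced by `f : M → N` (universal property of the
groupification; [FrdI] §0). [cite: MochizukiEtTh2009, Def 3.3 p.73] -/
noncomputable def gpMap (f : M →* N) : Algebra.GrothendieckGroup M →* Algebra.GrothendieckGroup N :=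
  Algebra.GrothendieckGroup.lift (Algebra.GrothendieckGroup.of.comp f)

/-- `gpMap f` extends `f`. [cite: MochizukiEtTh2009, Def 3.3 p.73] -/
@[simp] theorem gpMap_of (f : M →* N) (a : M) :
    gpMap f (Algebra.GrothendieckGroup.of a) = Algebra.GrothendieckGroup.of (f a) := by
  have h := Algebra.GrothendieckGroup.lift.symm_apply_apply (Algebra.GrothendieckGroup.of.comp f)
  rw [Algebra.GrothendieckGroup.lift_symm_apply] at h
  exact DFunLike.congr_fun h a

end Gp

/-! ## [FrdI] vocabulary not yet in the tree (hypothesis structure) -/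

/-- The [FrdI] MONOID notions used by [EtTh] §§3–4 that are not yet available under
`Literature/AlgebraicGeometry/Frobenioids/`, carried as an explicit HYPOTHESIS STRUCTURE so that
every statement below is parametric in them (merge pass: instantiate with the landed definitions).
Each field quotes the owner's printed definition. TODO-merge(abc-iut-L1-t2) for [FrdI] Def. 2.4,
TODO-merge(abc-iut-found) for [FrdI] Def. 1.1 (pending p402423).
[cite: MochizukiEtTh2009, Def 3.6 p.76] -/
structure FrdIMonoidStub : Type (w + 1) where
  /-- [FrdI] Def. 2.4 (i) (kurims p.47): `M` is *perf-factorial* — (a) divisorial, (b) every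
  `M_𝔭` monoprime, (c) the factorization homomorphism `M^pf → ∏_𝔭 M_𝔭^rlf` is well-defined and
  injective with image in `∏_𝔭 M_𝔭^pf`. TODO-merge(abc-iut-L1-t2) -/
  IsPerfFactorial : ∀ (M : Type w) [CommMonoid M], Prop
  /-- [FrdI] Def. 2.4 (i) (kurims p.48): `ι : M → N` exhibits `N` as the *realification* `M^rlf`
  of the perf-factorial monoid `M` (the submonoid of `∏_𝔭 M_𝔭^rlf` of elements whose support is
  contained in the support of an element of `M^pf`), compatibly with `M → M^pf → M^rlf`.
  TODO-merge(abc-iut-L1-t2) -/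
  IsRealification : ∀ (M N : Type w) [CommMonoid M] [CommMonoid N], (M →* N) → Prop
  /-- [FrdI] Def. 2.4 (ii) (c) (kurims p.48): "`ℝ` supports `M`": `M` is perfect and perf-factorial
  and every `M_𝔭` is `ℝ`-monoprime. TODO-merge(abc-iut-L1-t2) -/
  RSupports : ∀ (M : Type w) [CommMonoid M], Prop
  /-- [FrdI] Def. 1.1 (i) (kurims p.19): the endomorphism is *non-dilating* (found:
  `IsNonDilating`, pending p402423). TODO-merge(abc-iut-found) -/
  IsNonDilating : ∀ (M : Type w) [CommMonoid M], (M →* M) → Prop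

/-- The [FrdI] notions about MONOIDS ON A CATEGORY `D` used by [EtTh] §§3–4 that are not yet in
the tree, as a hypothesis structure (one per category). TODO-merge(abc-iut-found) for [FrdI]
Def. 1.1 (pending p402423), TODO-merge(abc-iut-L1-t3) for [FrdI] Def. 4.5.
[cite: MochizukiEtTh2009, Def 3.6 p.77] -/
structure FrdICatStub (D : Type u) [Category.{v} D] : Type (max u v (w + 1)) where
  /-- [FrdI] Def. 1.1 (i), (ii) (kurims pp.19–20): `Φ` is a *divisorial monoid on `D`* (found:
  `IsMonoidOn Φ ∧ Objectwise IsDivisorial Φ`). TODO-merge(abc-iut-found) -/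
  IsDivisorialOn : (Dᵒᵖ ⥤ CommMonCat.{w}) → Prop
  /-- [FrdI] Def. 4.5 (ii) (kurims p.86): the divisorial monoid `Φ` on `D` is *rational* (the
  model Frobenioid is of rational type — "a property which is completely determined by `Φ`",
  [EtTh] Def 3.6 (ii) p.77). TODO-merge(abc-iut-L1-t3) -/
  IsRational : (Dᵒᵖ ⥤ CommMonCat.{w}) → Prop
  /-- [FrdI] Def. 4.5 (ii) (kurims p.86): *strictly rational*. TODO-merge(abc-iut-L1-t3) -/
  IsStrictlyRational : (Dᵒᵖ ⥤ CommMonCat.{w}) → Prop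

/-! ## Definition 3.3 (iii) (p.73): the data `Φ₀`, `B₀`, `B₀ → Φ₀^gp`, `F₀` -/

/-- **Definition 3.3 (iii)** (p.73), output of the inductive-limit construction over the
`Δ^fil`-closures (see the module docstring for the verbatim definition): the monoids
`Φ₀(Y) = lim Div⁺(Z^log_∞)^{Gal(Z^log_∞/Y)}` and `B₀(Y) = lim Mero(Z^log_∞)^{Gal(Z^log_∞/Y)}` as
contravariant functors on the category `D₀ = B^temp(X^log)⁰` of connected tempered coverings,
the natural transformation `B₀ → Φ₀^gp` ("assigning to a log-meromorphic function its log-divisor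
of zeroes and poles"), the subfunctor `F₀ ⊆ B₀` of constant log-meromorphic functions, and the
submonoids of elements "arising from" non-cuspidal / cuspidal log-divisors (used in Def. 3.6 (iii)).
DATA, not constructed here (TODO-merge(abc-iut-L3-t2): the tower of universal combinatorial
coverings). [cite: MochizukiEtTh2009, Def 3.3 p.73] -/
structure DivisorMonoids (D₀ : Type u) [Category.{v} D₀] : Type (max u v (w + 1)) where
  /-- `Φ₀ : D₀ → 𝔐𝔬𝔫` (contravariant: pull-back of log-divisors along coverings) -/
  Φ₀ : D₀ᵒᵖ ⥤ CommMonCat.{w}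
  /-- `B₀ : D₀ → 𝔐𝔬𝔫`, the log-meromorphic functions (a group-valued monoid) -/
  B₀ : D₀ᵒᵖ ⥤ CommMonCat.{w}
  /-- every element of `B₀(Y)` is invertible (`B₀(Y)` is a group of functions) -/
  isUnit_B₀ : ∀ (Y : D₀ᵒᵖ) (b : B₀.obj Y), IsUnit b
  /-- the natural transformation `B₀ → Φ₀^gp`, objectwise -/
  div₀ : ∀ Y : D₀ᵒᵖ, (B₀.obj Y : Type w) →* Algebra.GrothendieckGroup (Φ₀.obj Y)
  /-- naturality of `B₀ → Φ₀^gp` -/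
  div₀_natural : ∀ {Y Y' : D₀ᵒᵖ} (f : Y ⟶ Y') (b : B₀.obj Y),
    div₀ Y' ((B₀.map f).hom b) = gpMap (Φ₀.map f).hom (div₀ Y b)
  /-- `F₀ ⊆ B₀`: "the subfunctor determined by the constant log-meromorphic functions" -/
  F₀ : ∀ Y : D₀ᵒᵖ, Submonoid (B₀.obj Y)
  /-- `F₀` is a subfunctor: stable under the maps `B₀(f)` -/
  F₀_map : ∀ {Y Y' : D₀ᵒᵖ} (f : Y ⟶ Y') (b : B₀.obj Y), b ∈ F₀ Y → (B₀.map f).hom b ∈ F₀ Y'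
  /-- elements of `Φ₀(Y)` arising from non-cuspidal log-divisors (Def 3.1 (i); Def 3.6 (iii)) -/
  ncsp₀ : ∀ Y : D₀ᵒᵖ, Submonoid (Φ₀.obj Y)
  /-- elements of `Φ₀(Y)` arising from cuspidal log-divisors (Def 3.1 (i); Def 3.6 (iii)) -/
  csp₀ : ∀ Y : D₀ᵒᵖ, Submonoid (Φ₀.obj Y)
  /-- pull-back preserves non-cuspidality -/
  ncsp₀_map : ∀ {Y Y' : D₀ᵒᵖ} (f : Y ⟶ Y') (x : Φ₀.obj Y), x ∈ ncsp₀ Y → (Φ₀.map f).hom x ∈ ncsp₀ Y'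
  /-- pull-back preserves cuspidality -/
  csp₀_map : ∀ {Y Y' : D₀ᵒᵖ} (f : Y ⟶ Y') (x : Φ₀.obj Y), x ∈ csp₀ Y → (Φ₀.map f).hom x ∈ csp₀ Y'
  /-- every element of `Φ₀(Y)` is uniquely a non-cuspidal times a cuspidal one (log-divisors are
  supported in "the union of the special fiber and divisor of cusps", Def 3.1 (i) p.70) -/
  existsUnique_ncsp_csp : ∀ (Y : D₀ᵒᵖ) (x : Φ₀.obj Y),
    ∃! p : ncsp₀ Y × csp₀ Y, (p.1 : Φ₀.obj Y) * p.2 = x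

namespace DivisorMonoids

variable {D₀ : Type u} [Category.{v} D₀] (T : DivisorMonoids.{u, v, w} D₀)

/-- `Φ₀^birat ⊆ Φ₀^gp`: "whose image we denote by `Φ₀^birat`" (Def 3.3 (iii), p.73).
[cite: MochizukiEtTh2009, Def 3.3 p.73] -/
noncomputable def birat (Y : D₀ᵒᵖ) : Submonoid (Algebra.GrothendieckGroup (T.Φ₀.obj Y)) :=
  MonoidHom.mrange (T.div₀ Y)

/-- `Φ₀^cnst ⊆ Φ₀^gp`: "the image of `F₀` in `Φ₀^gp`" (Def 3.3 (iii), p.73).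
[cite: MochizukiEtTh2009, Def 3.3 p.73] -/
noncomputable def cnst (Y : D₀ᵒᵖ) : Submonoid (Algebra.GrothendieckGroup (T.Φ₀.obj Y)) :=
  (T.F₀ Y).map (T.div₀ Y)

/-- `Φ₀^cnst ⊆ Φ₀^birat`. [cite: MochizukiEtTh2009, Def 3.3 p.73] -/
theorem cnst_le_birat (Y : D₀ᵒᵖ) : T.cnst Y ≤ T.birat Y := by
  rintro _ ⟨b, _, rfl⟩
  exact ⟨b, rfl⟩

/-! ### Remark 3.3.1 (pp.73–74) — documentation
"Note that the set of primes [cf. [FrdI], §0] of the monoid `Div⁺(Z^log_∞)^{Gal(Z^log_∞/Y^log)}`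
appearing in the definition of `Φ₀(Y^log)` is in natural bijective correspondence with the set of
`Gal(Z^log_∞/Y^log)`-orbits of prime log-divisors on `Z^log_∞` [cf. Proposition 3.2, (i)].
Moreover, since, by definition, different `Δ^fil`-closures `Z^log_∞ → Y^log` differ only by an
extension of the base field `K`, it follows immediately that in the inductive limit appearing in
the definition of `Φ₀(Y^log)`, the maps between monoids induce isomorphisms of monoids on the
respective perfections, hence that the resulting sets of primes map bijectively to one another."
(Remark 3.3.1 (i) in the cell's node list.) This is a statement about the un-typed inductive
system; no declaration is made for it here. -/

/-- **Proposition 3.4** "(Divisor and Rational Function Monoids)" (p.74), as a hypothesis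
structure on the data `T` (it is proved in print for the geometric `Φ₀`, `B₀`; here `Φ₀`, `B₀` are
abstract data, so the proposition is what an instance must supply). (i) "`Φ₀(Y^log)` [is]
perf-factorial … every endomorphism of `Φ₀(Y^log)` … induced by an endomorphism of `Y^log` over
`X^log` is non-dilating … the functor `Φ₀` defines a divisorial monoid on `D₀` which is, moreover,
perf-factorial and non-dilating." (ii) for `Y^log` geometrically connected over a finite extension
`L` of `K`: "`O_L^× ≅ Ker(B₀(Y^log) → Φ₀^gp(Y^log))`; `O_L^▷ ≅ B₀(Y^log) ×_{Φ₀^gp(Y^log)} Φ₀(Y^log)`;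
`L^× ≅ F₀(Y^log)`" — rendered by its two consequences used later: the kernel of `B₀ → Φ₀^gp` and
the functions with effective divisor are constant. The clause of (i) about the individual monoids
`Div⁺(Z^log_∞)^{Gal}` of the inductive system is not representable on the data `T` and is omitted.
[cite: MochizukiEtTh2009, Prop 3.4 p.74] -/
structure Prop34 (V : FrdIMonoidStub.{w}) (V₀ : FrdICatStub.{u, v, w} D₀) : Prop where
  /-- (i) "`Φ₀(Y^log)` … is perf-factorial" -/
  isPerfFactorial : ∀ Y : D₀ᵒᵖ, V.IsPerfFactorial (T.Φ₀.obj Y)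
  /-- (i) "every endomorphism of `Φ₀(Y^log)` … induced by an endomorphism of `Y^log` over `X^log` is
  non-dilating" -/
  isNonDilating : ∀ (Y : D₀ᵒᵖ) (f : Y ⟶ Y), V.IsNonDilating (T.Φ₀.obj Y) (T.Φ₀.map f).hom
  /-- (i) "the functor `Φ₀` defines a divisorial monoid on `D₀`" -/
  isDivisorialOn : V₀.IsDivisorialOn T.Φ₀
  /-- (ii), first isomorphism: a log-meromorphic function with trivial divisor is constant
  (`Ker(B₀(Y) → Φ₀^gp(Y)) = O_L^× ⊆ L^× = F₀(Y)`) -/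
  ker_div₀_le_F₀ : ∀ (Y : D₀ᵒᵖ) (b : T.B₀.obj Y), T.div₀ Y b = 1 → b ∈ T.F₀ Y
  /-- (ii), second isomorphism: a log-meromorphic function with effective divisor is constant
  (`B₀(Y) ×_{Φ₀^gp(Y)} Φ₀(Y) = O_L^▷ ⊆ F₀(Y)`) -/
  mem_F₀_of_div₀_mem : ∀ (Y : D₀ᵒᵖ) (b : T.B₀.obj Y) (x : T.Φ₀.obj Y),
    T.div₀ Y b = Algebra.GrothendieckGroup.of x → b ∈ T.F₀ Y

end DivisorMonoids

/-! ## Lemma 3.5 and Remarks 3.5.1, 3.5.2 (pp.75–76) -/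

section Lemma35

variable (V : FrdIMonoidStub.{w})

/-- **Lemma 3.5** "(Perfections and Realifications of Perf-factorial Submonoids)" (p.75), (i):
"Let `P`, `Q` be perf-factorial monoids such that: (a) `P` is a submonoid of `Q`; (b) `P` is
group-saturated [cf. §0] in `Q`; (c) `ℝ` supports `Q` [cf. [FrdI], Definition 2.4, (ii)]. Then:
(i) The inclusion `P ↪ Q` extends uniquely to inclusions `P^pf ↪ Q`, `P^rlf ↪ Q`." Named fact over
the [FrdI] vocabulary `V` (realification clause via `V.IsRealification`); the `P^pf` clause is
stated with the tree's `Perfection`. [cite: MochizukiEtTh2009, Lem 3.5 p.75] -/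
def Lemma35_i : Prop :=
  ∀ (Q : Type w) [CommMonoid Q] (P : Submonoid Q),
    V.IsPerfFactorial P → V.IsPerfFactorial Q → IsGroupSaturated P → V.RSupports Q →
      (∃! ιpf : Perfection P →* Q, ιpf.comp (Perfection.of P) = P.subtype) ∧
      (∀ ιpf : Perfection P →* Q, ιpf.comp (Perfection.of P) = P.subtype → Function.Injective ιpf) ∧
      ∀ (R : Type w) [CommMonoid R] (ρ : (P : Type w) →* R), V.IsRealification P R ρ →
        (∃! ιrlf : R →* Q, ιrlf.comp ρ = P.subtype) ∧
        ∀ ιrlf : R →* Q, ιrlf.comp ρ = P.subtype → Function.Injective ιrlf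

/-- **Lemma 3.5 (ii)** (p.75): "Relative to the inclusions of (i), `P^pf`, `P^rlf` are
group-saturated in `Q`." [cite: MochizukiEtTh2009, Lem 3.5 p.75] -/
def Lemma35_ii : Prop :=
  ∀ (Q : Type w) [CommMonoid Q] (P : Submonoid Q),
    V.IsPerfFactorial P → V.IsPerfFactorial Q → IsGroupSaturated P → V.RSupports Q →
      (∀ ιpf : Perfection P →* Q, ιpf.comp (Perfection.of P) = P.subtype →
        IsGroupSaturated (MonoidHom.mrange ιpf)) ∧
      ∀ (R : Type w) [CommMonoid R] (ρ : (P : Type w) →* R), V.IsRealification P R ρ →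
        ∀ ιrlf : R →* Q, ιrlf.comp ρ = P.subtype → IsGroupSaturated (MonoidHom.mrange ιrlf)

/-- **Remark 3.5.1** (p.76): "it follows immediately from Lemma 3.5, (i), that a nonzero submonoid
`P` of an `ℝ`-monoprime [cf. [FrdI], §0] monoid `Q` is perf-factorial and group-saturated if and
only if it is monoprime." [cite: MochizukiEtTh2009, Rmk 3.5.1 p.76] -/
def Remark351 : Prop :=
  ∀ (Q : Type w) [CommMonoid Q] (P : Submonoid Q), IsRMonoprime Q → P ≠ ⊥ →
    (V.IsPerfFactorial P ∧ IsGroupSaturated P ↔ IsMonoprime P)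

end Lemma35

/-! ### Remark 3.5.2 (p.76), PROVED in concrete form
"Note that the injectivity portion of Lemma 3.5, (i), fails to hold if one omits the crucial
hypothesis that `P` is group-saturated in `Q`. Indeed, this may be seen, for instance, by
considering an injection `P := ℤ_{≥0} ⊕ ℤ_{≥0} ↪ Q := ℝ_{≥0}` that sends the elements `(1,0)`;
`(0,1)` of `P` to [nonzero] `ℚ`-linearly independent elements of `ℝ_{≥0}`." We take the images
`1` and `√2`; `P^rlf = ℝ_{≥0} ⊕ ℝ_{≥0}` ([FrdI] Def 2.4 (i) for the free monoid `P`), and the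
`ℝ_{≥0}`-linear extension `(s,t) ↦ s + t√2` is the induced map `P^rlf → Q`. Additive notation
(Mathlib `NNReal`) for this remark only. -/

namespace Remark352

open NNReal

/-- The map `P = ℤ_{≥0} ⊕ ℤ_{≥0} → Q = ℝ_{≥0}`, `(m, n) ↦ m + n√2` (Remark 3.5.2, p.76).
[cite: MochizukiEtTh2009, Rmk 3.5.2 p.76] -/
noncomputable def embed : ℕ × ℕ →+ ℝ≥0 where
  toFun p := (p.1 : ℝ≥0) + (p.2 : ℝ≥0) * NNReal.sqrt 2
  map_zero' := by simp
  map_add' p q := by push_cast [Prod.fst_add, Prod.snd_add]; ring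

/-- Its `ℝ_{≥0}`-linear extension `P^rlf = ℝ_{≥0} ⊕ ℝ_{≥0} → ℝ_{≥0}`, `(s, t) ↦ s + t√2`.
[cite: MochizukiEtTh2009, Rmk 3.5.2 p.76] -/
noncomputable def embedRlf : ℝ≥0 × ℝ≥0 →+ ℝ≥0 where
  toFun p := p.1 + p.2 * NNReal.sqrt 2
  map_zero' := by simp
  map_add' p q := by simp only [Prod.fst_add, Prod.snd_add]; ring

/-- `embedRlf` extends `embed`. [cite: MochizukiEtTh2009, Rmk 3.5.2 p.76] -/
theorem embedRlf_natCast (p : ℕ × ℕ) : embedRlf ((p.1 : ℝ≥0), (p.2 : ℝ≥0)) = embed p := rfl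

/-- The images `1`, `√2` of the generators are `ℚ`-linearly independent, so `embed` is injective
("an injection `P ↪ Q`"). [cite: MochizukiEtTh2009, Rmk 3.5.2 p.76] -/
theorem embed_injective : Function.Injective embed := by
  rintro ⟨m, n⟩ ⟨m', n'⟩ h
  have h' : (m : ℝ) + n * Real.sqrt 2 = m' + n' * Real.sqrt 2 := by
    have := congrArg (fun x : ℝ≥0 => (x : ℝ)) h
    simpa [embed, Real.coe_sqrt] using this
  by_cases hn : (n : ℝ) = n'
  · rw [hn] at h'
    have hm : (m : ℝ) = m' := by linarith
    exact Prod.ext (by exact_mod_cast hm) (by exact_mod_cast hn)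
  · exfalso
    have hirr := irrational_sqrt_two
    apply hirr.ne_rat ((m - m' : ℚ) / (n' - n : ℚ))
    have hne : (n' : ℝ) - n ≠ 0 := fun h0 => hn (by linarith)
    rw [Rat.cast_div, Rat.cast_sub, Rat.cast_sub, Rat.cast_natCast, Rat.cast_natCast,
      Rat.cast_natCast, Rat.cast_natCast, eq_div_iff hne]
    linarith

/-- `P` is not group-saturated in `Q`: `√2 - 1 = embed (0,1) - embed (1,0)` lies in `Q = ℝ_{≥0}`
but not in the image of `P` (the "crucial hypothesis" that fails, p.76). Stated additively:
there are `a, b ∈ P` and `q ∈ Q ∖ P` with `q + embed b = embed a`.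
[cite: MochizukiEtTh2009, Rmk 3.5.2 p.76] -/
theorem not_groupSaturated :
    ∃ (q : ℝ≥0) (a b : ℕ × ℕ), q + embed b = embed a ∧ q ∉ Set.range embed := by
  refine ⟨NNReal.sqrt 2 - 1, (0, 1), (1, 0), ?_, ?_⟩
  · have h1 : (1 : ℝ≥0) ≤ NNReal.sqrt 2 := by
      rw [NNReal.one_le_sqrt]; norm_num
    simp only [embed, AddMonoidHom.coe_mk, ZeroHom.coe_mk, Nat.cast_zero, Nat.cast_one, one_mul,
      zero_mul, add_zero, zero_add]
    exact tsub_add_cancel_of_le h1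
  · rintro ⟨⟨m, n⟩, h⟩
    have h' : (m : ℝ) + n * Real.sqrt 2 = Real.sqrt 2 - 1 := by
      have h1 : (1 : ℝ≥0) ≤ NNReal.sqrt 2 := by rw [NNReal.one_le_sqrt]; norm_num
      have := congrArg (fun x : ℝ≥0 => (x : ℝ)) h
      simpa [embed, NNReal.coe_sub h1, Real.coe_sqrt] using this
    -- `(n - 1) √2 = -(m + 1)`: impossible as `√2` is irrational and `m + 1 ≠ 0`
    by_cases hn : (n : ℝ) = 1
    · rw [hn, one_mul] at h'
      have hm : (0 : ℝ) ≤ m := Nat.cast_nonneg m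
      linarith
    · apply irrational_sqrt_two.ne_rat ((-(m : ℚ) - 1) / ((n : ℚ) - 1))
      have hne : (n : ℝ) - 1 ≠ 0 := sub_ne_zero.mpr hn
      rw [Rat.cast_div, Rat.cast_sub, Rat.cast_sub, Rat.cast_neg, Rat.cast_natCast,
        Rat.cast_natCast, Rat.cast_one, eq_div_iff hne]
      linarith

/-- … and the extension to the realification is NOT injective: `(√2, 0)` and `(0, 1)` have the
same image `√2` ("the injectivity portion of Lemma 3.5, (i), fails", p.76).
[cite: MochizukiEtTh2009, Rmk 3.5.2 p.76] -/
theorem embedRlf_not_injective : ¬ Function.Injective embedRlf := by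
  intro h
  have h1 : embedRlf (NNReal.sqrt 2, 0) = embedRlf (0, 1) := by simp [embedRlf]
  have h2 := congrArg Prod.snd (h h1)
  simp at h2

end Remark352

end Literature.AnabelianGeometry.EtaleTheta
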